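import Summits.QuantumFields.YangMills.Theorems.UnitScaleTiltFluctuationComparisonRegPrPrintChiSlack
import HarnessLib

/-!
# `UnitScaleTiltInteriorExcisionInner` — OWNER RULING g22-№3 §B2(b): THE INNER SOCKET BY NAME for the re-typed item 19935ᴵ (card C8 «edge band to the tail») —
# `innerBodyAt_of_laneRecords_slackOnChi` (per block size and margin), `innerBody_of_slackOnChi` (2′ ∧ (i)* ⟹ the inner body of `InteriorExcision.regPrIntL_of_innerChi'`
# at every odd `L < 7`, margin `μ_L = 1 − 2/(L√L)`), `innerBody_of_full` (the registered 4′/large-L full-window body ⟹ the inner body: drop the two χ-guards)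

Lane ym-ust-19935-r1 (first refusal, B2(b)); count-neutral (`--supports stmt-QuantumFields-19935`).  = part 8's `fourPrime_of_slackOnChi_edge` with the edge leg REMOVED: (A) by the
landed `repAtHeights_dataOfV3` weakened to `TwoSidedRepOn χ`, thresholds `exists_gamma_thresholds`, χ-S-E″ `pintCauchyOn_of_globalSupRateTSlackOn` via its registered-shape slot,
socket `stubBodyOn_of_repOn_of_cauchyOn`.  Pure bookkeeping; nothing of [Balaban1985UV3]/[King1986] asserted.

References: C. King, CMP 102 (1986) 649–677 [King1986] (Thm 3.4 (3.9) p.656); T. Bałaban, CMP 102 (1985) 255–275 [Balaban1985UV3] ((41) p.266, (47) p.267).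
-/

noncomputable section

namespace Summit.QuantumFields.YangMills.Theorems.InteriorExcision

open MeasureTheory Filter
open Literature.MathematicalPhysics.QuantumFieldTheory.Balaban1983to89
open Literature.MathematicalPhysics.QuantumFieldTheory.Balaban1983to89.T3ContinuumYM3Torus
open Literature.MathematicalPhysics.QuantumFieldTheory.Balaban1983to89.T3UnitLawDensityEML (ℰp measurableE_ℰp)
open Literature.MathematicalPhysics.QuantumFieldTheory.Balaban1983to89.T3UnitScaleTilt
open Literature.MathematicalPhysics.QuantumFieldTheory.Balaban1983to89.T3TiltDescent
open Literature.MathematicalPhysics.QuantumFieldTheory.Balaban1983to89.T3PrintedRegularMinimiser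
open Literature.MathematicalPhysics.QuantumFieldTheory.Balaban1983to89.T3LogComparisonSocket
open Literature.MathematicalPhysics.QuantumFieldTheory.Balaban1983to89.T3AlphaInputsAC
open Summit.QuantumFields.YangMills.Theorems.PrintChi
open Summit.QuantumFields.YangMills.Theorems.GlobalSlack

/-- **THE INNER BODY AT ONE BLOCK SIZE AND ONE MARGIN from 2′(L) and the K1a-on-χ row at `(L, μ)`** — part 8's per-family chain without the edge leg: record with
`(𝔠.b₀, 𝔠.p₀) = (b₀, p₀)`, (A) by `repAtHeights_dataOfV3` (every block size) ⇒ `TwoSidedRepOn χ`, thresholds `exists_gamma_thresholds`, χ-S-E″ (registered-shape slot),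
`stubBodyOn_of_repOn_of_cauchyOn`. [cite: King1986, Thm 3.4 (3.9) p.656] -/
theorem innerBodyAt_of_laneRecords_slackOnChi (L : ℕ) (hLo : Odd L) (hL : 1 < L) (μ : ℝ)
    (h2 : Summit.QuantumFields.YangMills.Theorems.AlphaInputsT3ACv3Rec L)
    (hIμ :
      ∀ (𝔠 : Summit.QuantumFields.Balaban3D.Proofs.Primitives.AlphaConsts L (Summit.QuantumFields.Balaban3D.Carriers.suGroupModel 2).N)
        (a₀ a₁ : ℝ), 0 < a₀ → 0 < a₁ → 𝔠.B₃ * a₁ ≤ a₀ →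
        ∃ a : ℝ, 0 < a ∧ ∃ γB : ℝ, 0 < γB ∧ ∀ (F : T3Family) (γ : ℝ) (hF : F.L = L) (hγ : 0 < γ), γ ≤ γB →
          ∀ (hγ1 : γ ≤ (min (hF ▸ 𝔠).gamma0 1) ^ 2),
            Summit.QuantumFields.YangMills.Theorems.AlphaInputsT3AC.OfV3At F (hF ▸ 𝔠) a₀ a₁ →
            ∃ (p : ∀ K, Summit.QuantumFields.YangMills.Theorems.AlphaInputsT3AC.PkgAtV3 F (hF ▸ 𝔠) γ hγ hγ1 K),
              (∀ K, (p K).a₀ = a₀ ∧ (p K).a₁ = a₁) ∧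
              ∃ (π : Summit.QuantumFields.YangMills.Theorems.AlphaInputsT3AC.PolymerT3 F) (σ : ℕ) (C : ℝ), 7 ≤ σ ∧ 0 ≤ C ∧
                ∀ ε₀ : ℝ, 0 < ε₀ → ε₀ ≤ a₀ →
                  GlobalSupRateTSlackOn (fun K n h V => ChiGood F γ (hF ▸ 𝔠).b₀ (hF ▸ 𝔠).p₀ ε₀ μ (n := n) (K := K) h V)
                    (Summit.QuantumFields.YangMills.Theorems.AlphaInputsT3AC.dataOfV3 p π) (hF ▸ 𝔠).b₀ (hF ▸ 𝔠).p₀ a σ C) :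
    ∃ (b₁ p₁ : ℝ), ∀ (b₀ p₀ : ℝ), b₁ ≤ b₀ → p₁ ≤ p₀ → 0 < b₀ → 2 < p₀ →
      ∃ ε₁ : ℝ, 0 < ε₁ ∧ ∀ (ε₀ : ℝ), 0 < ε₀ → ε₀ ≤ ε₁ → ∃ m₀ : ℕ, ∀ (m : ℕ), m₀ ≤ m →
        ∃ γ₁ : ℝ, 0 < γ₁ ∧ ∀ (F : T3Family) (γ : ℝ), F.L = L → 0 < γ → γ ≤ γ₁ →
          ∃ (r κ : ℕ → ℝ), Summable r ∧ (∀ K, 0 ≤ r K) ∧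
            ∀ K, ∀ᵐ V ∂fieldMeasure (F.P (K / m)) 0 (Matrix.specialUnitaryGroup (Fin 2) ℂ),
              PlaqSmall (θBal F.L γ b₀ p₀ (K / m)) V →
                ChiGood F γ b₀ p₀ ε₀ μ (Nat.div_le_self K m) V →
                ChiGood F γ b₀ p₀ ε₀ μ ((Nat.div_le_self K m).trans (Nat.le_succ K)) V →
                0 < heightDensity F γ (Nat.div_le_self K m) (histGood F ℰp (θBal F.L γ b₀ p₀) K (K / m)) V →
                0 < heightDensity F γ ((Nat.div_le_self K m).trans (Nat.le_succ K))
                      (histGood F ℰp (θBal F.L γ b₀ p₀) (K + 1) (K / m)) V →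
                  |(Real.log (heightDensity F γ ((Nat.div_le_self K m).trans (Nat.le_succ K))
                        (histGood F ℰp (θBal F.L γ b₀ p₀) (K + 1) (K / m)) V) + bgRegPr' F γ m ε₀ K V) -
                    (Real.log (heightDensity F γ (Nat.div_le_self K m) (histGood F ℰp (θBal F.L γ b₀ p₀) K (K / m)) V) + bgRegPr F γ m ε₀ K V) -
                      κ K| ≤ r K := by
  obtain ⟨b₁, p₁, hrec⟩ := h2
  refine ⟨b₁, p₁, fun b₀ p₀ hb1 hp1 hb hp => ?_⟩
  obtain ⟨𝔠, a₀, a₁, hcb, hcp, ha0, ha1, hw, h𝔠⟩ := hrec b₀ p₀ hb1 hp1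
  subst hcb
  subst hcp
  obtain ⟨a, ha, γB, hγB, hBC⟩ := hIμ 𝔠 a₀ a₁ ha0 ha1 hw
  obtain ⟨εs, hεs, hS⟩ := levelCauchyOnOfGlobalSupRateTSlackOn_dec L hLo hL a ha
  refine ⟨min a₀ εs, lt_min ha0 hεs, fun ε₀ h0 h1 => ?_⟩
  have h1a : ε₀ ≤ a₀ := h1.trans (min_le_left _ _)
  have h1s : ε₀ ≤ εs := h1.trans (min_le_right _ _)
  obtain ⟨m₀, hm₀⟩ := hS ε₀ h0 h1s
  refine ⟨max m₀ 1, fun m hm => ?_⟩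
  have hmpos : 0 < m := Nat.lt_of_lt_of_le Nat.one_pos ((le_max_right _ _).trans hm)
  obtain ⟨γT, hγT, -, hT⟩ := Summit.QuantumFields.YangMills.Theorems.LogComparisonAlphaAdapter.exists_gamma_thresholds
    (B₃ := 𝔠.B₃) 𝔠.b₀_pos 𝔠.p₀_pos ha1 𝔠.B₃_pos.le h0
  have hg0 : 0 < (min 𝔠.gamma0 1) ^ 2 := pow_pos (lt_min 𝔠.gamma0_pos one_pos) 2
  obtain ⟨γs, hγs, hS'⟩ := hm₀ m ((le_max_left _ _).trans hm) 𝔠.b₀ 𝔠.p₀ hb hp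
  refine ⟨min (min γB (min γT ((min 𝔠.gamma0 1) ^ 2))) γs,
    lt_min (lt_min hγB (lt_min hγT hg0)) hγs, fun F γ hF hγ hγ₁ => ?_⟩
  subst hF
  have hγB' : γ ≤ γB := hγ₁.trans ((min_le_left _ _).trans (min_le_left _ _))
  have hγT' : γ ≤ γT := hγ₁.trans ((min_le_left _ _).trans ((min_le_right _ _).trans (min_le_left _ _)))
  have hγ1 : γ ≤ (min 𝔠.gamma0 1) ^ 2 := hγ₁.trans ((min_le_left _ _).trans ((min_le_right _ _).trans (min_le_right _ _)))
  have hγs' : γ ≤ γs := hγ₁.trans (min_le_right _ _)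
  obtain ⟨p, hp', π, σ, C, hσ, hC0, hG⟩ := hBC F γ rfl hγ hγB' hγ1 (h𝔠 F rfl)
  obtain ⟨hT1, hT2, hT3⟩ := hT F.L F.hL.2.le γ hγ hγT'
  have hRep := Summit.QuantumFields.YangMills.Theorems.AlphaInputsT3AC.repAtHeights_dataOfV3 p π hp' ε₀ h0 h1a hT1 hT2 hT3
  have hrepOn : TwoSidedRepOn F γ 𝔠.b₀ 𝔠.p₀ (fun K n h V => ChiGood F γ 𝔠.b₀ 𝔠.p₀ ε₀ μ (n := n) (K := K) h V) ε₀
      (Summit.QuantumFields.YangMills.Theorems.AlphaInputsT3AC.dataOfV3 p π).PintH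
      (Summit.QuantumFields.YangMills.Theorems.AlphaInputsT3AC.dataOfV3 p π).EcstH
      (Summit.QuantumFields.YangMills.Theorems.AlphaInputsT3AC.dataOfV3 p π).RmH :=
    twoSidedRepOn_of_repAt _ hRep
  have hCau := hS' F γ rfl hγ hγs' (fun K n h V => ChiGood F γ 𝔠.b₀ 𝔠.p₀ ε₀ μ (n := n) (K := K) h V)
    (Summit.QuantumFields.YangMills.Theorems.AlphaInputsT3AC.dataOfV3 p π) σ C hσ hC0 (hG ε₀ h0 h1a)
  obtain ⟨r, κ, hr, hr0, hC⟩ := stubBodyOn_of_repOn_of_cauchyOn F γ 𝔠.b₀ 𝔠.p₀ ε₀ hmpos _ _ _ _ hrepOn hCau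
  refine ⟨r, κ, hr, hr0, fun K => ?_⟩
  filter_upwards [hC K] with V hV
  intro hs hχ hχ' h0' h0''
  exact hV hs hχ hχ' h0' h0''

/-- Print's transfer margin `μ_L = 1 − 2/(L√L)` lies in `(0,1)` for every `L ≥ 2` (`L√L ≥ 2√2 > 2`). [folklore] -/
theorem muL_pos_lt_one {L : ℕ} (hL : 1 < L) : 0 < 1 - 2 / ((L : ℝ) * Real.sqrt L) ∧ 1 - 2 / ((L : ℝ) * Real.sqrt L) < 1 := by
  have hL2 : (2 : ℝ) ≤ L := by exact_mod_cast hL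
  have hs : Real.sqrt 2 ≤ Real.sqrt L := Real.sqrt_le_sqrt hL2
  have hs2 : 1 < Real.sqrt 2 := by
    rw [show (1 : ℝ) = Real.sqrt 1 by rw [Real.sqrt_one]]
    exact Real.sqrt_lt_sqrt (by norm_num) (by norm_num)
  have hLs : 2 < (L : ℝ) * Real.sqrt L := by nlinarith
  have hLs0 : 0 < (L : ℝ) * Real.sqrt L := by linarith
  constructor
  · rw [sub_pos, div_lt_one hLs0]; exact hLs
  · have : 0 < 2 / ((L : ℝ) * Real.sqrt L) := by positivity
    linarith

/-- **`innerBody_of_slackOnChi` — OWNER RULING g22-№3 §B2(b)**: the registered lane-records stub 2′ and the sanctioned inner stub (i)* (`Stub4primeChiTextsV2.lean` verbatim: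
K1a-on-χ for EVERY margin, odd `L < 7`) give, at every odd `1 < L < 7`, the INNER BODY of `InteriorExcision.regPrIntL_of_innerChi'` at print's margin `μ_L = 1 − 2/(L√L)`.
[cite: King1986, Thm 3.4 (3.9) p.656] -/
theorem innerBody_of_slackOnChi
    (h2 : ∀ L : ℕ, Odd L → 1 < L → Summit.QuantumFields.YangMills.Theorems.AlphaInputsT3ACv3Rec L)
    (hI : ∀ (L : ℕ), Odd L → 1 < L → L < 7 → ∀ (μ : ℝ), 0 < μ → μ < 1 →
      ∀ (𝔠 : Summit.QuantumFields.Balaban3D.Proofs.Primitives.AlphaConsts L (Summit.QuantumFields.Balaban3D.Carriers.suGroupModel 2).N)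
        (a₀ a₁ : ℝ), 0 < a₀ → 0 < a₁ → 𝔠.B₃ * a₁ ≤ a₀ →
        ∃ a : ℝ, 0 < a ∧ ∃ γB : ℝ, 0 < γB ∧ ∀ (F : T3Family) (γ : ℝ) (hF : F.L = L) (hγ : 0 < γ), γ ≤ γB →
          ∀ (hγ1 : γ ≤ (min (hF ▸ 𝔠).gamma0 1) ^ 2),
            Summit.QuantumFields.YangMills.Theorems.AlphaInputsT3AC.OfV3At F (hF ▸ 𝔠) a₀ a₁ →
            ∃ (p : ∀ K, Summit.QuantumFields.YangMills.Theorems.AlphaInputsT3AC.PkgAtV3 F (hF ▸ 𝔠) γ hγ hγ1 K),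
              (∀ K, (p K).a₀ = a₀ ∧ (p K).a₁ = a₁) ∧
              ∃ (π : Summit.QuantumFields.YangMills.Theorems.AlphaInputsT3AC.PolymerT3 F) (σ : ℕ) (C : ℝ), 7 ≤ σ ∧ 0 ≤ C ∧
                ∀ ε₀ : ℝ, 0 < ε₀ → ε₀ ≤ a₀ →
                  GlobalSupRateTSlackOn (fun K n h V => ChiGood F γ (hF ▸ 𝔠).b₀ (hF ▸ 𝔠).p₀ ε₀ μ (n := n) (K := K) h V)
                    (Summit.QuantumFields.YangMills.Theorems.AlphaInputsT3AC.dataOfV3 p π) (hF ▸ 𝔠).b₀ (hF ▸ 𝔠).p₀ a σ C) :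
    ∀ (L : ℕ), Odd L → 1 < L → L < 7 →
    ∃ (b₁ p₁ : ℝ), ∀ (b₀ p₀ : ℝ), b₁ ≤ b₀ → p₁ ≤ p₀ → 0 < b₀ → 2 < p₀ →
      ∃ ε₁ : ℝ, 0 < ε₁ ∧ ∀ (ε₀ : ℝ), 0 < ε₀ → ε₀ ≤ ε₁ → ∃ m₀ : ℕ, ∀ (m : ℕ), m₀ ≤ m →
        ∃ γ₁ : ℝ, 0 < γ₁ ∧ ∀ (F : T3Family) (γ : ℝ), F.L = L → 0 < γ → γ ≤ γ₁ →
          ∃ (r κ : ℕ → ℝ), Summable r ∧ (∀ K, 0 ≤ r K) ∧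
            ∀ K, ∀ᵐ V ∂fieldMeasure (F.P (K / m)) 0 (Matrix.specialUnitaryGroup (Fin 2) ℂ),
              PlaqSmall (θBal F.L γ b₀ p₀ (K / m)) V →
                ChiGood F γ b₀ p₀ ε₀ (1 - 2 / ((F.L : ℝ) * Real.sqrt F.L)) (Nat.div_le_self K m) V →
                ChiGood F γ b₀ p₀ ε₀ (1 - 2 / ((F.L : ℝ) * Real.sqrt F.L)) ((Nat.div_le_self K m).trans (Nat.le_succ K)) V →
                0 < heightDensity F γ (Nat.div_le_self K m) (histGood F ℰp (θBal F.L γ b₀ p₀) K (K / m)) V →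
                0 < heightDensity F γ ((Nat.div_le_self K m).trans (Nat.le_succ K))
                      (histGood F ℰp (θBal F.L γ b₀ p₀) (K + 1) (K / m)) V →
                  |(Real.log (heightDensity F γ ((Nat.div_le_self K m).trans (Nat.le_succ K))
                        (histGood F ℰp (θBal F.L γ b₀ p₀) (K + 1) (K / m)) V) + bgRegPr' F γ m ε₀ K V) -
                    (Real.log (heightDensity F γ (Nat.div_le_self K m) (histGood F ℰp (θBal F.L γ b₀ p₀) K (K / m)) V) + bgRegPr F γ m ε₀ K V) -
                      κ K| ≤ r K := by
  intro L hLo hL hL7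
  obtain ⟨hμ0, hμ1⟩ := muL_pos_lt_one hL
  obtain ⟨b₁, p₁, H⟩ := innerBodyAt_of_laneRecords_slackOnChi L hLo hL (1 - 2 / ((L : ℝ) * Real.sqrt L)) (h2 L hLo hL)
    (hI L hLo hL hL7 _ hμ0 hμ1)
  refine ⟨b₁, p₁, fun b₀ p₀ hb1 hp1 hb hp => ?_⟩
  obtain ⟨ε₁, hε₁, H1⟩ := H b₀ p₀ hb1 hp1 hb hp
  refine ⟨ε₁, hε₁, fun ε₀ h0 h1 => ?_⟩
  obtain ⟨m₀, H2⟩ := H1 ε₀ h0 h1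
  refine ⟨m₀, fun m hm => ?_⟩
  obtain ⟨γ₁, hγ₁, H3⟩ := H2 m hm
  refine ⟨γ₁, hγ₁, fun F γ hF hγ hγle => ?_⟩
  have H4 := H3 F γ hF hγ hγle
  subst hF
  exact H4

/-- **`innerBody_of_full`** — the full-window body (the registered 4′ clause shape ∕ the large-`L` chain's output) implies the inner body at any margin: drop the two χ-guards.
[cite: King1986, Thm 3.4 (3.9) p.656] -/
theorem innerBody_of_full (L : ℕ) (μ : ℝ)
    (hfull : ∃ (b₁ p₁ : ℝ), ∀ (b₀ p₀ : ℝ), b₁ ≤ b₀ → p₁ ≤ p₀ → 0 < b₀ → 2 < p₀ →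
      ∃ ε₁ : ℝ, 0 < ε₁ ∧ ∀ (ε₀ : ℝ), 0 < ε₀ → ε₀ ≤ ε₁ → ∃ m₀ : ℕ, ∀ (m : ℕ), m₀ ≤ m →
        ∃ γ₁ : ℝ, 0 < γ₁ ∧ ∀ (F : T3Family) (γ : ℝ), F.L = L → 0 < γ → γ ≤ γ₁ →
          ∃ (r κ : ℕ → ℝ), Summable r ∧ (∀ K, 0 ≤ r K) ∧
            ∀ K, ∀ᵐ V ∂fieldMeasure (F.P (K / m)) 0 (Matrix.specialUnitaryGroup (Fin 2) ℂ),
              PlaqSmall (θBal F.L γ b₀ p₀ (K / m)) V →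
                0 < heightDensity F γ (Nat.div_le_self K m) (histGood F ℰp (θBal F.L γ b₀ p₀) K (K / m)) V →
                0 < heightDensity F γ ((Nat.div_le_self K m).trans (Nat.le_succ K))
                      (histGood F ℰp (θBal F.L γ b₀ p₀) (K + 1) (K / m)) V →
                  |(Real.log (heightDensity F γ ((Nat.div_le_self K m).trans (Nat.le_succ K))
                        (histGood F ℰp (θBal F.L γ b₀ p₀) (K + 1) (K / m)) V) + bgRegPr' F γ m ε₀ K V) -
                    (Real.log (heightDensity F γ (Nat.div_le_self K m) (histGood F ℰp (θBal F.L γ b₀ p₀) K (K / m)) V) + bgRegPr F γ m ε₀ K V) -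
                      κ K| ≤ r K) :
    ∃ (b₁ p₁ : ℝ), ∀ (b₀ p₀ : ℝ), b₁ ≤ b₀ → p₁ ≤ p₀ → 0 < b₀ → 2 < p₀ →
      ∃ ε₁ : ℝ, 0 < ε₁ ∧ ∀ (ε₀ : ℝ), 0 < ε₀ → ε₀ ≤ ε₁ → ∃ m₀ : ℕ, ∀ (m : ℕ), m₀ ≤ m →
        ∃ γ₁ : ℝ, 0 < γ₁ ∧ ∀ (F : T3Family) (γ : ℝ), F.L = L → 0 < γ → γ ≤ γ₁ →
          ∃ (r κ : ℕ → ℝ), Summable r ∧ (∀ K, 0 ≤ r K) ∧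
            ∀ K, ∀ᵐ V ∂fieldMeasure (F.P (K / m)) 0 (Matrix.specialUnitaryGroup (Fin 2) ℂ),
              PlaqSmall (θBal F.L γ b₀ p₀ (K / m)) V →
                ChiGood F γ b₀ p₀ ε₀ μ (Nat.div_le_self K m) V →
                ChiGood F γ b₀ p₀ ε₀ μ ((Nat.div_le_self K m).trans (Nat.le_succ K)) V →
                0 < heightDensity F γ (Nat.div_le_self K m) (histGood F ℰp (θBal F.L γ b₀ p₀) K (K / m)) V →
                0 < heightDensity F γ ((Nat.div_le_self K m).trans (Nat.le_succ K))
                      (histGood F ℰp (θBal F.L γ b₀ p₀) (K + 1) (K / m)) V →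
                  |(Real.log (heightDensity F γ ((Nat.div_le_self K m).trans (Nat.le_succ K))
                        (histGood F ℰp (θBal F.L γ b₀ p₀) (K + 1) (K / m)) V) + bgRegPr' F γ m ε₀ K V) -
                    (Real.log (heightDensity F γ (Nat.div_le_self K m) (histGood F ℰp (θBal F.L γ b₀ p₀) K (K / m)) V) + bgRegPr F γ m ε₀ K V) -
                      κ K| ≤ r K := by
  obtain ⟨b₁, p₁, H⟩ := hfull
  refine ⟨b₁, p₁, fun b₀ p₀ hb1 hp1 hb hp => ?_⟩
  obtain ⟨ε₁, hε₁, H1⟩ := H b₀ p₀ hb1 hp1 hb hp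
  refine ⟨ε₁, hε₁, fun ε₀ h0 h1 => ?_⟩
  obtain ⟨m₀, H2⟩ := H1 ε₀ h0 h1
  refine ⟨m₀, fun m hm => ?_⟩
  obtain ⟨γ₁, hγ₁, H3⟩ := H2 m hm
  refine ⟨γ₁, hγ₁, fun F γ hF hγ hγle => ?_⟩
  obtain ⟨r, κ, hr, hr0, hC⟩ := H3 F γ hF hγ hγle
  refine ⟨r, κ, hr, hr0, fun K => ?_⟩
  filter_upwards [hC K] with V hV
  intro hs _ _ h0' h0''
  exact hV hs h0' h0''

/-- The same at print's margin `μ_L = 1 − 2/(L√L)` with the `F.L`-spelling used by `regPrIntL_of_innerChi'`. [cite: King1986, Thm 3.4 (3.9) p.656] -/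
theorem innerBody_of_full_muL (L : ℕ)
    (hfull : ∃ (b₁ p₁ : ℝ), ∀ (b₀ p₀ : ℝ), b₁ ≤ b₀ → p₁ ≤ p₀ → 0 < b₀ → 2 < p₀ →
      ∃ ε₁ : ℝ, 0 < ε₁ ∧ ∀ (ε₀ : ℝ), 0 < ε₀ → ε₀ ≤ ε₁ → ∃ m₀ : ℕ, ∀ (m : ℕ), m₀ ≤ m →
        ∃ γ₁ : ℝ, 0 < γ₁ ∧ ∀ (F : T3Family) (γ : ℝ), F.L = L → 0 < γ → γ ≤ γ₁ →
          ∃ (r κ : ℕ → ℝ), Summable r ∧ (∀ K, 0 ≤ r K) ∧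
            ∀ K, ∀ᵐ V ∂fieldMeasure (F.P (K / m)) 0 (Matrix.specialUnitaryGroup (Fin 2) ℂ),
              PlaqSmall (θBal F.L γ b₀ p₀ (K / m)) V →
                0 < heightDensity F γ (Nat.div_le_self K m) (histGood F ℰp (θBal F.L γ b₀ p₀) K (K / m)) V →
                0 < heightDensity F γ ((Nat.div_le_self K m).trans (Nat.le_succ K))
                      (histGood F ℰp (θBal F.L γ b₀ p₀) (K + 1) (K / m)) V →
                  |(Real.log (heightDensity F γ ((Nat.div_le_self K m).trans (Nat.le_succ K))
                        (histGood F ℰp (θBal F.L γ b₀ p₀) (K + 1) (K / m)) V) + bgRegPr' F γ m ε₀ K V) -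
                    (Real.log (heightDensity F γ (Nat.div_le_self K m) (histGood F ℰp (θBal F.L γ b₀ p₀) K (K / m)) V) + bgRegPr F γ m ε₀ K V) -
                      κ K| ≤ r K) :
    ∃ (b₁ p₁ : ℝ), ∀ (b₀ p₀ : ℝ), b₁ ≤ b₀ → p₁ ≤ p₀ → 0 < b₀ → 2 < p₀ →
      ∃ ε₁ : ℝ, 0 < ε₁ ∧ ∀ (ε₀ : ℝ), 0 < ε₀ → ε₀ ≤ ε₁ → ∃ m₀ : ℕ, ∀ (m : ℕ), m₀ ≤ m →
        ∃ γ₁ : ℝ, 0 < γ₁ ∧ ∀ (F : T3Family) (γ : ℝ), F.L = L → 0 < γ → γ ≤ γ₁ →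
          ∃ (r κ : ℕ → ℝ), Summable r ∧ (∀ K, 0 ≤ r K) ∧
            ∀ K, ∀ᵐ V ∂fieldMeasure (F.P (K / m)) 0 (Matrix.specialUnitaryGroup (Fin 2) ℂ),
              PlaqSmall (θBal F.L γ b₀ p₀ (K / m)) V →
                ChiGood F γ b₀ p₀ ε₀ (1 - 2 / ((F.L : ℝ) * Real.sqrt F.L)) (Nat.div_le_self K m) V →
                ChiGood F γ b₀ p₀ ε₀ (1 - 2 / ((F.L : ℝ) * Real.sqrt F.L)) ((Nat.div_le_self K m).trans (Nat.le_succ K)) V →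
                0 < heightDensity F γ (Nat.div_le_self K m) (histGood F ℰp (θBal F.L γ b₀ p₀) K (K / m)) V →
                0 < heightDensity F γ ((Nat.div_le_self K m).trans (Nat.le_succ K))
                      (histGood F ℰp (θBal F.L γ b₀ p₀) (K + 1) (K / m)) V →
                  |(Real.log (heightDensity F γ ((Nat.div_le_self K m).trans (Nat.le_succ K))
                        (histGood F ℰp (θBal F.L γ b₀ p₀) (K + 1) (K / m)) V) + bgRegPr' F γ m ε₀ K V) -
                    (Real.log (heightDensity F γ (Nat.div_le_self K m) (histGood F ℰp (θBal F.L γ b₀ p₀) K (K / m)) V) + bgRegPr F γ m ε₀ K V) -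
                      κ K| ≤ r K := by
  obtain ⟨b₁, p₁, H⟩ := hfull
  refine ⟨b₁, p₁, fun b₀ p₀ hb1 hp1 hb hp => ?_⟩
  obtain ⟨ε₁, hε₁, H1⟩ := H b₀ p₀ hb1 hp1 hb hp
  refine ⟨ε₁, hε₁, fun ε₀ h0 h1 => ?_⟩
  obtain ⟨m₀, H2⟩ := H1 ε₀ h0 h1
  refine ⟨m₀, fun m hm => ?_⟩
  obtain ⟨γ₁, hγ₁, H3⟩ := H2 m hm
  refine ⟨γ₁, hγ₁, fun F γ hF hγ hγle => ?_⟩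
  obtain ⟨r, κ, hr, hr0, hC⟩ := H3 F γ hF hγ hγle
  refine ⟨r, κ, hr, hr0, fun K => ?_⟩
  filter_upwards [hC K] with V hV
  intro hs _ _ h0' h0''
  exact hV hs h0' h0''

end Summit.QuantumFields.YangMills.Theorems.InteriorExcision

end
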